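import Literature.AlgebraicTopology.SingularHomology.TorusCohomology
import Mathlib.Topology.ContinuousMap.Algebra
import HarnessLib

/-!
# The cohomology ring of the torus: `ξᵢ ⌣ ξⱼ = -ξⱼ ⌣ ξᵢ`, `ξᵢ ⌣ ξᵢ = 0`, primitivity of `θ`
# and the action of integer matrices on `H¹(Tⁿ)`

A. Hatcher, *Algebraic Topology* (2002), Example 3.16: `H*(Tⁿ; R) = Λ_R[α₁, …, αₙ]`
("`αᵢαⱼ = -αⱼαᵢ`, `αᵢ² = 0`"), and §3.C Exercise 11 / the computation behind Example 2.32 and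
§3.3 p. 231: a linear map `A ∈ Mₘₓₙ(ℤ)` induces `f_A : Tⁿ → Tᵐ` with `f_A^* αᵢ = Σⱼ Aᵢⱼ αⱼ` on
`H¹`. Sequel of `TorusCohomology.lean` (the cup-monomial basis `ξ_s` of `Hᵏ(Tⁿ; F)`, the sub-tori
`subtorus s : Tᵏ → Tⁿ` and the forms normalised on the top monomials):

* `cupProduct_torusXi_comm` — `ξᵢ ⌣ ξⱼ = -(ξⱼ ⌣ ξᵢ)` in `H²(Tⁿ; R)`, every commutative ring `R`
  (the tree's graded commutativity `cupProduct_gradedComm_holds`, Hatcher Thm. 3.11);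
* over a field `F`: `subsingleton_singularCohomology_torus_of_lt` — `Hᵏ(Tⁿ; F) = 0` for `k > n`
  (`bₖ = (n choose k) = 0`); `cupProduct_circleClass_self` — `θ ⌣ θ = 0` in `H²(ℝ/ℤ; F)`
  (`ℝ/ℤ ≅ T¹`); `cupProduct_torusXi_self` — `ξᵢ ⌣ ξᵢ = 0`;
* `ext_of_map_subtorus` — a class in `Hᵏ(Tⁿ; F)` is determined by its restrictions to the `k`-sub-tori
  (its coordinate at `ξ_s` is `f(ι_s^* c)`);
* **`map_torusAdd_circleClass`** — **primitivity**: for the sum map `σ : T² → ℝ/ℤ`,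
  `(x₀, x₁) ↦ x₀ + x₁`, `σ^*θ = ξ₀ + ξ₁` in `H¹(T²; F)` (restrict to the two axes);
* **`map_add_circleClass`** — `(f + g)^*θ = f^*θ + g^*θ` in `H¹(X; F)` for continuous
  `f, g : X → ℝ/ℤ` (factor through `T²`), with `map_zero_circleClass`, `map_neg_circleClass`,
  `map_sub_circleClass`, `map_sum_circleClass`, `map_zsmul_circleClass`;
* **`map_torusMap_torusXi`** — for `A ∈ Mₘₓₙ(ℤ)` and `f_A : Tⁿ → Tᵐ`, `(f_A x)ᵢ = Σⱼ Aᵢⱼ xⱼ`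
  (`torusMap A`), **`f_A^* ξᵢ = Σⱼ Aᵢⱼ ξⱼ`** in `H¹(Tⁿ; F)`.

With `map_cupMonomial` (`TorusCohomology.lean`) the last item determines `f_A^*` on all of
`H*(Tⁿ; F)` by multilinearity. Everything is proved; no named facts.

## References

* A. Hatcher, *Algebraic Topology*, CUP 2002, §3.2 Example 3.16, Thm. 3.11; §3.C Exercise 11;
  §3.3 p. 231. [HatcherAT2002]
-/

noncomputable section

open CategoryTheory Limits Set

universe u v

namespace Literature.AlgebraicTopology.SingularHomology

/-! ### Anticommutativity -/

section Ring

variable {R : Type v} [CommRing R] {n : ℕ}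

/-- Composition of pull-backs, pointwise: `f^*(g^* y) = (g ∘ f)^* y`. [cite: HatcherAT2002, §3.1 p. 201] -/
theorem singularCohomology.map_map {M : Type v} [AddCommGroup M] [Module R M] {X Y Z : Type u}
    [TopologicalSpace X] [TopologicalSpace Y] [TopologicalSpace Z] (f : C(X, Y)) (g : C(Y, Z)) (k : ℕ)
    (y : singularCohomology R M Z k) :
    singularCohomology.map R M f k (singularCohomology.map R M g k y) = singularCohomology.map R M (g.comp f) k y := by
  rw [singularCohomology.map_comp]
  rfl

/-- **`ξᵢ ⌣ ξⱼ = -(ξⱼ ⌣ ξᵢ)`** in `H²(Tⁿ; R)` (graded commutativity, Hatcher 2002, Thm. 3.11 /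
Example 3.16 "`αᵢαⱼ = -αⱼαᵢ`"). [cite: HatcherAT2002, §3.2 Example 3.16] -/
theorem cupProduct_torusXi_comm (i j : Fin n) :
    cupProduct (rfl : 1 + 1 = 1 + 1) (torusXi R n i) (torusXi R n j) =
      -cupProduct (rfl : 1 + 1 = 1 + 1) (torusXi R n j) (torusXi R n i) := by
  rw [cupProduct_gradedComm_holds R (Torus n) rfl rfl (torusXi R n i) (torusXi R n j), mul_one, pow_one,
    neg_one_smul]

end Ring

/-! ### Vanishing above the dimension; `θ ⌣ θ = 0` -/

section Field

variable (F : Type v) [Field F] {n k : ℕ}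

/-- **`Hᵏ(Tⁿ; F) = 0` for `k > n`** (`bₖ(Tⁿ) = (n choose k) = 0`). [cite: HatcherAT2002, §3.2 Example 3.16] -/
theorem subsingleton_singularCohomology_torus_of_lt (h : n < k) :
    Subsingleton (singularCohomology F F (Torus n) k) := by
  haveI := finite_singularCohomology_torus F n k
  have hr : Module.finrank F (singularCohomology F F (Torus n) k) = 0 := by
    rw [finrank_singularCohomology_torus, Nat.choose_eq_zero_of_lt h]
  exact Module.finrank_zero_iff.1 hr

/-- `H²(ℝ/ℤ; F) = 0` (`ℝ/ℤ ≅ T¹`). [cite: HatcherAT2002, §3.2 Example 3.16] -/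
theorem subsingleton_singularCohomology_unitAddCircle_two :
    Subsingleton (singularCohomology F F UnitAddCircle 2) := by
  haveI := subsingleton_singularCohomology_torus_of_lt F (n := 1) (k := 2) one_lt_two
  exact (singularCohomology.mapIso F F (Homeomorph.funUnique (Fin 1) UnitAddCircle) 2).toLinearEquiv
    |>.toEquiv.subsingleton

/-- **`θ ⌣ θ = 0`** in `H²(ℝ/ℤ; F)`. [cite: HatcherAT2002, §3.2 Example 3.16] -/
theorem cupProduct_circleClass_self :
    cupProduct (rfl : 1 + 1 = 1 + 1) (circleClass F) (circleClass F) = 0 := by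
  haveI := subsingleton_singularCohomology_unitAddCircle_two F
  exact Subsingleton.elim _ _

variable {F}

/-- **`ξᵢ ⌣ ξᵢ = 0`** in `H²(Tⁿ; F)` (Hatcher 2002, Example 3.16 "`αᵢ² = 0`"). [cite: HatcherAT2002, §3.2 Example 3.16] -/
theorem cupProduct_torusXi_self (i : Fin n) :
    cupProduct (rfl : 1 + 1 = 1 + 1) (torusXi F n i) (torusXi F n i) = 0 := by
  rw [torusXi, ← cupProduct_map, cupProduct_circleClass_self, map_zero]

/-! ### Classes are determined by their restrictions to the `k`-sub-tori -/

/-- The coordinate of a class at the basis vector `ξ_s` is `f(ι_s^* c)` for any linear form `f`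
normalised on the top monomial of `Tᵏ`. [cite: HatcherAT2002, §3.2 Example 3.16] -/
theorem torusMonomialBasis_repr_eq (c : singularCohomology F F (Torus n) k)
    {f : singularCohomology F F (Torus k) k →ₗ[F] F} (hf : f (torusTop F k) = 1)
    (s : Set.powersetCard (Fin n) k) :
    (torusMonomialBasis F n k).repr c s = f (singularCohomology.map F F (subtorus s) k c) := by
  classical
  conv_rhs => rw [← (torusMonomialBasis F n k).sum_repr c]
  simp only [map_sum, map_smul, torusMonomialBasis_apply]
  rw [Finset.sum_eq_single_of_mem s (Finset.mem_univ s) (fun t _ hts => by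
      rw [map_subtorus_torusMonomial_of_ne hts, map_zero, smul_zero]),
    map_subtorus_torusMonomial_self, hf, smul_eq_mul, mul_one]

/-- **A class in `Hᵏ(Tⁿ; F)` is determined by its restrictions to the `k`-sub-tori.**
[cite: HatcherAT2002, §3.2 Example 3.16] -/
theorem ext_of_map_subtorus {c c' : singularCohomology F F (Torus n) k}
    (h : ∀ s : Set.powersetCard (Fin n) k,
      singularCohomology.map F F (subtorus s) k c = singularCohomology.map F F (subtorus s) k c') :
    c = c' := by
  obtain ⟨f, hf⟩ := exists_linearMap_torusTop F k
  refine (torusMonomialBasis F n k).repr.injective (Finsupp.ext fun s => ?_)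
  rw [torusMonomialBasis_repr_eq c hf, torusMonomialBasis_repr_eq c' hf, h s]

/-! ### Primitivity of `θ` -/

/-- **The sum map** `σ : T² → ℝ/ℤ`, `x ↦ x₀ + x₁`. [cite: HatcherAT2002, §3.C Exercise 11] -/
def torusAdd : C(Torus 2, UnitAddCircle) :=
  ⟨fun x => x 0 + x 1, (continuous_apply 0).add (continuous_apply 1)⟩

/-- Values of the sum map. [cite: HatcherAT2002, §3.C Exercise 11] -/
@[simp]
theorem torusAdd_apply (x : Torus 2) : torusAdd x = x 0 + x 1 := rfl

/-- A `1`-subset `t` of `Fin 2` is the singleton of its element `t₀ = subsetEmb t 0`. [folklore] -/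
theorem notMem_of_ne_subsetEmb (t : Set.powersetCard (Fin 2) 1) {j : Fin 2} (hj : j ≠ subsetEmb t 0) :
    j ∉ t.val := by
  intro hjt
  obtain ⟨i, rfl⟩ := exists_subsetEmb_eq t hjt
  exact hj (by rw [Subsingleton.elim i 0])

/-- On each axis of `T²` the sum map is the coordinate of that axis. [cite: HatcherAT2002, §3.C Exercise 11] -/
theorem torusAdd_comp_subtorus (t : Set.powersetCard (Fin 2) 1) :
    torusAdd.comp (subtorus t) = (torusProj 2 (subsetEmb t 0)).comp (subtorus t) := by
  ext y
  change (subtorus t y) 0 + (subtorus t y) 1 = (subtorus t y) (subsetEmb t 0)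
  have h0 : ∀ j : Fin 2, j ≠ subsetEmb t 0 → subtorus t y j = 0 := fun j hj => by
    have e := congrFun (congrArg DFunLike.coe (torusProj_comp_subtorus_of_notMem t (notMem_of_ne_subsetEmb t hj))) y
    exact e
  by_cases h : subsetEmb t 0 = 0
  · rw [h, h0 1 (by rw [h]; decide), add_zero]
  · have h1 : subsetEmb t 0 = 1 := Fin.eq_one_of_ne_zero _ h
    rw [h1, h0 0 (by rw [h1]; decide), zero_add]

variable (F)

/-- **Primitivity of `θ`**: `σ^*θ = ξ₀ + ξ₁` in `H¹(T²; F)` for the sum map `σ(x) = x₀ + x₁` —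
both sides restrict to the generator on each axis (Hatcher 2002, §3.C Exercise 11: the H-space
structure of `S¹`). [cite: HatcherAT2002, §3.C Exercise 11] -/
theorem map_torusAdd_circleClass :
    singularCohomology.map F F torusAdd 1 (circleClass F) = torusXi F 2 0 + torusXi F 2 1 := by
  refine ext_of_map_subtorus fun t => ?_
  have hl : singularCohomology.map F F (subtorus t) 1 (singularCohomology.map F F torusAdd 1 (circleClass F)) =
      torusXi F 1 0 := by
    rw [singularCohomology.map_map, torusAdd_comp_subtorus, ← singularCohomology.map_map]
    exact map_subtorus_torusXi_subsetEmb t 0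
  rw [hl, map_add]
  by_cases h : subsetEmb t 0 = 0
  · have e := map_subtorus_torusXi_subsetEmb (R := F) t 0
    rw [h] at e
    rw [e, map_subtorus_torusXi_of_notMem t (notMem_of_ne_subsetEmb t (by rw [h]; decide)),
      add_zero]
  · have h1 : subsetEmb t 0 = 1 := Fin.eq_one_of_ne_zero _ h
    have e := map_subtorus_torusXi_subsetEmb (R := F) t 0
    rw [h1] at e
    rw [e, map_subtorus_torusXi_of_notMem t (notMem_of_ne_subsetEmb t (by rw [h1]; decide)),
      zero_add]

variable {X : Type} [TopologicalSpace X]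

/-- The pairing map `(f, g) : X → T²`. [cite: HatcherAT2002, §3.C Exercise 11] -/
def torusPair (f g : C(X, UnitAddCircle)) : C(X, Torus 2) where
  toFun x := ![f x, g x]
  continuous_toFun := continuous_pi fun i => by
    fin_cases i
    · exact f.continuous
    · exact g.continuous

/-- `σ ∘ (f, g) = f + g`. [cite: HatcherAT2002, §3.C Exercise 11] -/
theorem torusAdd_comp_torusPair (f g : C(X, UnitAddCircle)) : torusAdd.comp (torusPair f g) = f + g := by
  ext x; rfl

/-- `p₀ ∘ (f, g) = f`. [cite: HatcherAT2002, §3.C Exercise 11] -/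
theorem torusProj_zero_comp_torusPair (f g : C(X, UnitAddCircle)) : (torusProj 2 0).comp (torusPair f g) = f := by
  ext x; rfl

/-- `p₁ ∘ (f, g) = g`. [cite: HatcherAT2002, §3.C Exercise 11] -/
theorem torusProj_one_comp_torusPair (f g : C(X, UnitAddCircle)) : (torusProj 2 1).comp (torusPair f g) = g := by
  ext x; rfl

/-- **Additivity: `(f + g)^*θ = f^*θ + g^*θ`** in `H¹(X; F)` for continuous `f, g : X → ℝ/ℤ`
(Hatcher 2002, §3.C Exercise 11 / the argument of §1.1 Thm. 1.7 for degree). [cite: HatcherAT2002, §3.C Exercise 11] -/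
theorem map_add_circleClass (f g : C(X, UnitAddCircle)) :
    singularCohomology.map F F (f + g) 1 (circleClass F) =
      singularCohomology.map F F f 1 (circleClass F) + singularCohomology.map F F g 1 (circleClass F) := by
  rw [← torusAdd_comp_torusPair, ← singularCohomology.map_map, map_torusAdd_circleClass, map_add, torusXi,
    torusXi, singularCohomology.map_map, singularCohomology.map_map, torusProj_zero_comp_torusPair,
    torusProj_one_comp_torusPair]

/-- `0^*θ = 0` (the zero map is constant). [cite: HatcherAT2002, §3.1 p. 198] -/
theorem map_zero_circleClass : singularCohomology.map F F (0 : C(X, UnitAddCircle)) 1 (circleClass F) = 0 :=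
  map_const_circleClass F (X := X) 0

/-- `(-f)^*θ = -f^*θ`. [cite: HatcherAT2002, §3.C Exercise 11] -/
theorem map_neg_circleClass (f : C(X, UnitAddCircle)) :
    singularCohomology.map F F (-f) 1 (circleClass F) = -singularCohomology.map F F f 1 (circleClass F) := by
  rw [eq_neg_iff_add_eq_zero, ← map_add_circleClass, neg_add_cancel, map_zero_circleClass]

/-- `(f - g)^*θ = f^*θ - g^*θ`. [cite: HatcherAT2002, §3.C Exercise 11] -/
theorem map_sub_circleClass (f g : C(X, UnitAddCircle)) :
    singularCohomology.map F F (f - g) 1 (circleClass F) =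
      singularCohomology.map F F f 1 (circleClass F) - singularCohomology.map F F g 1 (circleClass F) := by
  rw [sub_eq_add_neg, map_add_circleClass, map_neg_circleClass, sub_eq_add_neg]

/-- `(Σᵢ fᵢ)^*θ = Σᵢ fᵢ^*θ`. [cite: HatcherAT2002, §3.C Exercise 11] -/
theorem map_sum_circleClass {ι : Type*} (s : Finset ι) (f : ι → C(X, UnitAddCircle)) :
    singularCohomology.map F F (∑ i ∈ s, f i) 1 (circleClass F) =
      ∑ i ∈ s, singularCohomology.map F F (f i) 1 (circleClass F) := by
  classical
  induction s using Finset.induction_on with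
  | empty => rw [Finset.sum_empty, Finset.sum_empty, map_zero_circleClass]
  | insert a s ha ih => rw [Finset.sum_insert ha, Finset.sum_insert ha, map_add_circleClass, ih]

/-- `(m • f)^*θ = m • f^*θ` for `m ∈ ℤ`. [cite: HatcherAT2002, §3.C Exercise 11] -/
theorem map_zsmul_circleClass (m : ℤ) (f : C(X, UnitAddCircle)) :
    singularCohomology.map F F (m • f) 1 (circleClass F) = m • singularCohomology.map F F f 1 (circleClass F) := by
  induction m using Int.induction_on with
  | zero => rw [zero_smul, zero_smul, map_zero_circleClass]
  | succ m ih => rw [add_smul, one_smul, map_add_circleClass, ih, add_smul, one_smul]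
  | pred m ih => rw [sub_smul, one_smul, map_sub_circleClass, ih, sub_smul, one_smul]

/-! ### Integer matrices acting on tori -/

variable {m : ℕ}

/-- **The torus map of an integer matrix**: `f_A : Tⁿ → Tᵐ`, `(f_A x)ᵢ = Σⱼ Aᵢⱼ xⱼ` (Hatcher 2002,
§3.C Exercise 11; Example 2.32 for `n = m = 1`). [cite: HatcherAT2002, §3.C Exercise 11] -/
def torusMap (A : Matrix (Fin m) (Fin n) ℤ) : C(Torus n, Torus m) where
  toFun x i := ∑ j, A i j • x j
  continuous_toFun := continuous_pi fun i =>
    continuous_finsetSum _ fun j _ => (continuous_zsmul (A i j)).comp (continuous_apply j)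

/-- Values of the torus map. [cite: HatcherAT2002, §3.C Exercise 11] -/
@[simp]
theorem torusMap_apply (A : Matrix (Fin m) (Fin n) ℤ) (x : Torus n) (i : Fin m) :
    torusMap A x i = ∑ j, A i j • x j := rfl

/-- The coordinates of the torus map: `pᵢ ∘ f_A = Σⱼ Aᵢⱼ pⱼ`. [cite: HatcherAT2002, §3.C Exercise 11] -/
theorem torusProj_comp_torusMap (A : Matrix (Fin m) (Fin n) ℤ) (i : Fin m) :
    (torusProj m i).comp (torusMap A) = ∑ j, A i j • torusProj n j := by
  ext x
  simp only [ContinuousMap.comp_apply, torusProj_apply, torusMap_apply, ContinuousMap.coe_sum,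
    Finset.sum_apply, ContinuousMap.coe_smul, Pi.smul_apply]

/-- **`f_A^* ξᵢ = Σⱼ Aᵢⱼ ξⱼ`** in `H¹(Tⁿ; F)` (Hatcher 2002, §3.C Exercise 11: "`f_A^*` on `H¹` is
given by the transpose matrix"). [cite: HatcherAT2002, §3.C Exercise 11] -/
theorem map_torusMap_torusXi (A : Matrix (Fin m) (Fin n) ℤ) (i : Fin m) :
    singularCohomology.map F F (torusMap A) 1 (torusXi F m i) = ∑ j, (A i j : F) • torusXi F n j := by
  rw [torusXi, singularCohomology.map_map, torusProj_comp_torusMap, map_sum_circleClass]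
  refine Finset.sum_congr rfl fun j _ => ?_
  rw [map_zsmul_circleClass, torusXi, Int.cast_smul_eq_zsmul]

end Field

end Literature.AlgebraicTopology.SingularHomology
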